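/-
Copyright: the b2b-balaban T⁴-continuum CRUX team, row NE7b OWNER lineage `t4-ne7b-p1` (gen 121). Project licence.
-/
import Summits.QuantumFields.BalabanUV.T4Continuum.Spine.NE7b.SupTorusPropagatorLocality

/-!
# THE PROPAGATOR OF THE TORUS ROAD IS LIPSCHITZ IN THE BACKGROUND POTENTIAL, BLOCK-LOCALLY — MESH- AND VOLUME-FREE: for
# `H_V = (n+1)²(−Δ) + a(n+1)^{−d}(block sums) + V` on `(ℤ∕(n+1)s)^d`, two potentials `V₁, V₂ ≥ −λ` with `|V₁ − V₂| ≤ D` pointwise and a source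
# `f` supported in ONE block `y₀`, the solutions of `H_{V₁}u₁ = f`, `H_{V₂}u₂ = f` satisfy `Σ_{B_y}(u₁ − u₂)² ≤ C·D²·e^{−2δρ_s(y,y₀)}·Σf²` over
# EVERY block `y`, `(C, δ)` from `(d, a, λ)` only; through the COMMON GENERALISATION of (137)∕(138)'s source lemmas: `H⁻¹` maps a source
# with block profile `Ge^{−γρ_s(·,y₀)}` to a field with block profile `m_κ⁻¹Ge^{2dκ}√K_{2κ}·e^{−κρ_s(·,y₀)}`, `2κ ≤ γ`
# (row NE7b, node U5c; (131)–(133), (137), (138) BY NAME; [folklore])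

Cell `pub-balaban`, sub-cell `t4`, spine estimate NE7b (`T4WeightBudget.RelWeightBound`; the cell's OWN estimate — NOT PRINTED in
[Bałaban 1983–89], NOT PROVED).  Crux-route work under `Spine/NE7b/` by the row OWNER (`t4-ne7b-p1` gen 121, file (141)) under FREEZE
(0)'s crux-prover clause — the REGULARITY-IN-THE-BACKGROUND of the locality column ((81) `SupBackgroundDataModulus` did «Lipschitz in the
potential» for the sup road on `ℤ^d`; here block-locally on the torus); NOTHING of Bałaban's is named as a Lean object, valued or asserted; no
`T4Continuum/Support` leaf typed; no `def`, no notation (both actions DISPLAYED, `|V₁ − V₂| ≤ D` a displayed letter); zero `sorry`.  Imports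
(BY NAME): the OWNER's (138) `…SupTorusPropagatorLocality` (`blockSq_le_of_block_source`; through it (137) `rate_mono`, (133) `action_sub`,
`block_sum_le_total`, `weight_on_block`, (132) `torusDist_bond_lipschitz`, `isPseudoDist_torus`, `torus_sum_exp_le`, (131)
`inverseHessian_weighted_resolvent`, `exists_rate`, (89) TDFC `sum_sq_eq_sum_blocks`).

WHY (located).  In the road `V = u″∘φ` is the background's curvature; every object of the locality column (`H⁻¹`, `T`, `T⁻¹`, the response,
the covariance) must depend CONTINUOUSLY — block-locally and mesh-free — on the background for the effective action's fluctuation part to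
be regular.  The second resolvent identity displayed: `H_{V₁}(u₁ − u₂) = −(V₁ − V₂)u₂` ((133) `action_sub` + a `ring` identity), so `u₁ − u₂`
is `H_{V₁}⁻¹` of a source that is NOT in one block but has the BLOCK PROFILE `D·m_κ⁻¹e^{2dκ}e^{−κρ_s(·,y₀)}‖f‖` of `u₂` ((138)).  §1–§2
therefore generalise the column's source lemmas to block profiles: the weighted norm of such a source for the weight `(κ∕(n+1))ρ_N(·, corner
y₀)` is `≤ G²e^{2dκ}Σ_{y″}e^{(2κ − 2γ)ρ_s} ≤ G²e^{2dκ}K_{2κ}` when `2κ ≤ γ` ((133) `weight_on_block`, (132) `torus_sum_exp_le`), and (131)'s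
weighted resolvent letter read on the block `y` gives the block profile of the solution at the halved rate.  §3 applies this at the rate
`κ∕2` to `u₁ − u₂`; §4 fixes `κ` by (131) `exists_rate`.

WHAT IS PROVED ([folklore]; fine torus `Site d ((n+1)s)`, coarse `Site d s`, `[NeZero s]`; the action DISPLAYED; `bt x = σ_s(blk n (wm x))`;
`m_κ = min(2,a) − λ − 2dκ² − a(e^{2dκ} − 1)`; `ρ_s` = (132)'s distance written out; `K_α = (2∕(1 − e^{−α}))^d`):
* §1 **`weightedSq_le_of_blockProfile`** (`Σ_{B_{y″}}g² ≤ G²e^{−2γρ_s(y″,y₀)}` ∀ `y″`, `0 < κ`, `2κ ≤ γ` ⟹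
  `Σ_x (e^{κρ_N(x, corner y₀)∕(n+1)}g x)² ≤ G²e^{2dκ}K_{2κ}`).
* §2 **`blockSq_le_of_blockProfile_source`** (`Hh = g`, `V ≥ −λ`, `0 < κ ≤ 1`, `2κ ≤ γ`, `m_κ > 0` ⟹
  `Σ_z h(σ(chart (wm y) z))² ≤ m_κ⁻²(G²e^{2dκ}K_{2κ})e^{2dκ}·e^{−2κρ_s(y,y₀)}` for every block `y`).
* §3 `action_potential_sub` (`H_{V₁}u = H_{V₂}u + (V₁ − V₂)u`), `action_sub_of_potentials` (`H_{V₁}(u₁ − u₂) = −(V₁ − V₂)u₂`),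
  **`blockSq_sub_le_of_potentials`** (`V₁, V₂ ≥ −λ`, `|V₁ − V₂| ≤ D`, `f` in the block `y₀`, `H_{V_i}u_i = f` ⟹
  `Σ_z (u₁ − u₂)(σ(chart (wm y) z))² ≤ m_{κ∕2}⁻²(D²m_κ⁻²e^{4dκ}Σf²·e^{dκ}K_κ)e^{dκ}·e^{−κρ_s(y,y₀)}`).
* §4 THE HEADLINE **`propagator_lipschitz`**: `∃ C δ > 0` from `(d, a, λ)` only (`a ≥ 0`, `λ < min(2,a)`) such that for ALL `n, s`, ALL
  `V₁, V₂ ≥ −λ`, every `D` with `|V₁ − V₂| ≤ D`, every block `y₀`, every `f` supported in the block `y₀` and solutions `H_{V_i}u_i = f`: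
  `Σ_z (u₁ − u₂)(σ(chart (wm y) z))² ≤ C·D²·e^{−2δρ_s(y,y₀)}·Σf²` for every block `y`.
* §5 toy.

HONEST (what this is NOT).  Block-`ℓ²` currency; Lipschitz (first order) only — differentiability of `V ↦ H_V⁻¹` in the displayed sense
is the same identity iterated (not typed); the Schur complement `T`, its inverse and the covariance inherit the modulus by (134)'s block
Cauchy–Schwarz and two coarse convolutions — the sequel, not here; sources in one block; constants explicit, far from sharp; cubic
periods; scalar skeleton ((A3), NC-NE7b-α UNRULED); nothing of the covariant propagators of [B4]–[B6]; nothing of Bałaban's.  BY-NAME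
EFFECT ON THE WALL: NONE.  NE7b NOT PRINTED ∕ NOT PROVED; spine PROVED 0∕9; rung (B)+1 on a FINITE torus — NOT infinite volume, NOT the
mass gap, NOT Clay.  HONEST DEPENDENCY: continuum YM on T⁴ ⇐ BetaPertH ∧ nine spine estimates (0∕9 proved); BetaPertH ⇐ (D1) ∧ (D4) ∧
CAP+tail; G-an2-4 gates asym, D1 and NE2∕3∕4.
-/

set_option autoImplicit false

noncomputable section

namespace Summit.QuantumFields.BalabanUV.T4Continuum.NE7b.SupTorusPropagatorModulus

open Real
open Literature.MathematicalPhysics.QuantumFieldTheory.Balaban1983to89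
open B6QGQLower276 (X e blk B side chart mem_B sum_B sum_B_const card_cube blk_chart)
open Beta (Site siteOf windowMap siteOf_windowMap siteOf_add)
open SupTorusDirichletFormCoercive (sum_sq_eq_sum_blocks)
open SupTorusHessianCombesThomas (inverseHessian_weighted_resolvent exists_rate)
open SupTorusBlockDistance (torusDist_bond_lipschitz isPseudoDist_torus torus_sum_exp_le)
open SupTorusActionForm (action_sub block_sum_le_total weight_on_block)
open SupTorusResponseLocality (rate_mono)
open SupTorusPropagatorLocality (blockSq_le_of_block_source)

variable {d : ℕ}

/-! ## §1. The weighted norm of a source with an exponentially decaying BLOCK PROFILE -/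

section Profile

variable (n s : ℕ) [NeZero s]

/-- **A SOURCE WITH BLOCK PROFILE `G·e^{−γρ_s(·,y₀)}` HAS WEIGHTED NORM `≤ G²e^{2dκ}K_{2κ}`** for the weight `(κ∕(n+1))ρ_N(·, corner y₀)`,
`0 < κ`, `2κ ≤ γ`: if `Σ_z g(σ(chart (wm y″) z))² ≤ G²e^{−2γρ_s(y″,y₀)}` for every block `y″`, then
`Σ_x (e^{κρ_N(x, corner y₀)∕(n+1)}g x)² ≤ G²e^{2dκ}(2∕(1 − e^{−2κ}))^d` — the weight is `≤ e^{κρ_s(y″,y₀) + dκ}` on the block `y″` ((133)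
`weight_on_block`), `2κ − 2γ ≤ −2κ`, and (132) `torus_sum_exp_le`. [folklore] -/
theorem weightedSq_le_of_blockProfile {κ γ G : ℝ} (hκ : 0 < κ) (h2κ : 2 * κ ≤ γ) (y₀ : Site d s) (g : Site d ((n + 1) * s) → ℝ)
    (hg : ∀ y'' : Site d s, ∑ z : Fin d → Fin (n + 1), g (siteOf d ((n + 1) * s) (chart n (windowMap d s y'') z)) ^ 2
      ≤ G ^ 2 * exp (-(2 * γ * ∑ i, (((y'' i - y₀ i).valMinAbs.natAbs : ℕ) : ℝ)))) :
    ∑ x, (exp (κ / ((n : ℝ) + 1) * ∑ i, (((x i - (siteOf d ((n + 1) * s) (chart n (windowMap d s y₀) 0)) i).valMinAbs.natAbs : ℕ) : ℝ))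
        * g x) ^ 2
      ≤ G ^ 2 * exp (2 * d * κ) * (2 * (1 - exp (-(2 * κ)))⁻¹) ^ d := by
  classical
  rw [sum_sq_eq_sum_blocks n s]
  -- per block `y″`: `≤ e^{2(κρ_s + dκ)}·G²e^{−2γρ_s} ≤ G²e^{2dκ}e^{−2κρ_s(y″,y₀)}`
  have hblock : ∀ y'' : Site d s, ∑ z : Fin d → Fin (n + 1),
      (exp (κ / ((n : ℝ) + 1) * ∑ i, ((((siteOf d ((n + 1) * s) (chart n (windowMap d s y'') z)) i
        - (siteOf d ((n + 1) * s) (chart n (windowMap d s y₀) 0)) i).valMinAbs.natAbs : ℕ) : ℝ))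
        * g (siteOf d ((n + 1) * s) (chart n (windowMap d s y'') z))) ^ 2
      ≤ G ^ 2 * exp (2 * d * κ) * exp (-(2 * κ * ∑ i, (((y'' i - y₀ i).valMinAbs.natAbs : ℕ) : ℝ))) := by
    intro y''
    have hρ0 : 0 ≤ ∑ i, (((y'' i - y₀ i).valMinAbs.natAbs : ℕ) : ℝ) := Finset.sum_nonneg fun _ _ => Nat.cast_nonneg _
    calc ∑ z : Fin d → Fin (n + 1), (exp (κ / ((n : ℝ) + 1) * ∑ i, ((((siteOf d ((n + 1) * s) (chart n (windowMap d s y'') z)) i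
            - (siteOf d ((n + 1) * s) (chart n (windowMap d s y₀) 0)) i).valMinAbs.natAbs : ℕ) : ℝ))
            * g (siteOf d ((n + 1) * s) (chart n (windowMap d s y'') z))) ^ 2
        ≤ ∑ z : Fin d → Fin (n + 1), exp (2 * (κ * (∑ i, (((y'' i - y₀ i).valMinAbs.natAbs : ℕ) : ℝ)) + d * κ))
            * g (siteOf d ((n + 1) * s) (chart n (windowMap d s y'') z)) ^ 2 := by
          refine Finset.sum_le_sum fun z _ => ?_
          rw [mul_pow, ← exp_nat_mul, Nat.cast_ofNat]
          exact mul_le_mul_of_nonneg_right (exp_le_exp.2 (by linarith [(weight_on_block n s y'' y₀ z hκ.le).2])) (sq_nonneg _)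
      _ = exp (2 * (κ * (∑ i, (((y'' i - y₀ i).valMinAbs.natAbs : ℕ) : ℝ)) + d * κ))
            * ∑ z : Fin d → Fin (n + 1), g (siteOf d ((n + 1) * s) (chart n (windowMap d s y'') z)) ^ 2 := (Finset.mul_sum _ _ _).symm
      _ ≤ exp (2 * (κ * (∑ i, (((y'' i - y₀ i).valMinAbs.natAbs : ℕ) : ℝ)) + d * κ))
            * (G ^ 2 * exp (-(2 * γ * ∑ i, (((y'' i - y₀ i).valMinAbs.natAbs : ℕ) : ℝ)))) :=
          mul_le_mul_of_nonneg_left (hg y'') (exp_pos _).le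
      _ = G ^ 2 * exp (2 * (κ * (∑ i, (((y'' i - y₀ i).valMinAbs.natAbs : ℕ) : ℝ)) + d * κ)
            + -(2 * γ * ∑ i, (((y'' i - y₀ i).valMinAbs.natAbs : ℕ) : ℝ))) := by rw [exp_add]; ring
      _ ≤ G ^ 2 * (exp (2 * d * κ) * exp (-(2 * κ * ∑ i, (((y'' i - y₀ i).valMinAbs.natAbs : ℕ) : ℝ)))) := by
          rw [← exp_add]
          exact mul_le_mul_of_nonneg_left (exp_le_exp.2 (by nlinarith [mul_le_mul_of_nonneg_right h2κ hρ0])) (sq_nonneg _)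
      _ = _ := by ring
  have hsum : ∑ y'' : Site d s, exp (-(2 * κ * ∑ i, (((y'' i - y₀ i).valMinAbs.natAbs : ℕ) : ℝ)))
      ≤ (2 * (1 - exp (-(2 * κ)))⁻¹) ^ d := by
    have h := torus_sum_exp_le (d := d) s (by linarith : 0 < 2 * κ) y₀
    refine le_trans (le_of_eq (Finset.sum_congr rfl fun y'' _ => ?_)) h
    rw [(isPseudoDist_torus (d := d) s).symm y'' y₀]
  calc ∑ y'' : Site d s, ∑ z : Fin d → Fin (n + 1),
        (exp (κ / ((n : ℝ) + 1) * ∑ i, ((((siteOf d ((n + 1) * s) (chart n (windowMap d s y'') z)) i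
          - (siteOf d ((n + 1) * s) (chart n (windowMap d s y₀) 0)) i).valMinAbs.natAbs : ℕ) : ℝ))
          * g (siteOf d ((n + 1) * s) (chart n (windowMap d s y'') z))) ^ 2
      ≤ ∑ y'' : Site d s, G ^ 2 * exp (2 * d * κ) * exp (-(2 * κ * ∑ i, (((y'' i - y₀ i).valMinAbs.natAbs : ℕ) : ℝ))) :=
        Finset.sum_le_sum fun y'' _ => hblock y''
    _ = G ^ 2 * exp (2 * d * κ) * ∑ y'' : Site d s, exp (-(2 * κ * ∑ i, (((y'' i - y₀ i).valMinAbs.natAbs : ℕ) : ℝ))) := by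
        rw [Finset.mul_sum]
    _ ≤ G ^ 2 * exp (2 * d * κ) * (2 * (1 - exp (-(2 * κ)))⁻¹) ^ d := mul_le_mul_of_nonneg_left hsum (by positivity)

end Profile

/-! ## §2. A solution with a block-profile source decays in block `ℓ²` -/

section Solution

variable (n : ℕ) (a : ℝ) (s : ℕ) [NeZero s] (ha : 0 ≤ a) {lam κ γ G : ℝ} (hκ0 : 0 < κ) (hκ1 : κ ≤ 1)
  (hm : 0 < min 2 a - lam - 2 * d * κ ^ 2 - a * (exp (2 * d * κ) - 1)) (h2κ : 2 * κ ≤ γ)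
  (V : Site d ((n + 1) * s) → ℝ) (hV : ∀ x, -lam ≤ V x) (y₀ : Site d s) (h g : Site d ((n + 1) * s) → ℝ)
  (hg : ∀ y'' : Site d s, ∑ z : Fin d → Fin (n + 1), g (siteOf d ((n + 1) * s) (chart n (windowMap d s y'') z)) ^ 2
    ≤ G ^ 2 * exp (-(2 * γ * ∑ i, (((y'' i - y₀ i).valMinAbs.natAbs : ℕ) : ℝ))))
  (hh : ∀ x, ((n : ℝ) + 1) ^ 2 * ∑ μ, (2 * h x - h (x + siteOf d ((n + 1) * s) (e μ)) - h (x - siteOf d ((n + 1) * s) (e μ)))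
      + a / ((n : ℝ) + 1) ^ d * ∑ q ∈ B n (blk n (windowMap d ((n + 1) * s) x)), h (siteOf d ((n + 1) * s) q) + V x * h x = g x)

include ha hκ0 hκ1 hm h2κ hV hg hh in
/-- **BLOCK `ℓ²` DECAY OF `H⁻¹g` FOR A SOURCE WITH A BLOCK PROFILE** — the common generalisation of (137) `blockSq_le_of_decaying_source`
(block-constant sources) and (138) `blockSq_le_of_block_source` (sources in one block): if `Hh = g` (displayed action, `V ≥ −λ`),
`Σ_{B_{y″}}g² ≤ G²e^{−2γρ_s(y″,y₀)}` for every block, `0 < κ ≤ 1`, `2κ ≤ γ`, `m_κ > 0`, then over EVERY block `y`: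
`Σ_z h(σ(chart (wm y) z))² ≤ m_κ⁻²G²e^{4dκ}(2∕(1 − e^{−2κ}))^d·e^{−2κρ_s(y,y₀)}` — the rate halves, the size is the profile's, MESH-FREE.
[folklore] -/
theorem blockSq_le_of_blockProfile_source (y : Site d s) :
    ∑ z : Fin d → Fin (n + 1), h (siteOf d ((n + 1) * s) (chart n (windowMap d s y) z)) ^ 2
      ≤ ((min 2 a - lam - 2 * d * κ ^ 2 - a * (exp (2 * d * κ) - 1))⁻¹) ^ 2 * (G ^ 2 * exp (2 * d * κ)
          * (2 * (1 - exp (-(2 * κ)))⁻¹) ^ d) * exp (2 * d * κ) * exp (-(2 * κ * ∑ i, (((y i - y₀ i).valMinAbs.natAbs : ℕ) : ℝ))) := by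
  classical
  set m := min 2 a - lam - 2 * d * κ ^ 2 - a * (exp (2 * d * κ) - 1) with hm_def
  set c' : Site d ((n + 1) * s) := siteOf d ((n + 1) * s) (chart n (windowMap d s y₀) 0) with hc'
  set ρ : Site d ((n + 1) * s) → ℝ := fun x => ∑ i, (((x i - c' i).valMinAbs.natAbs : ℕ) : ℝ) with hρ_def
  have hρ : ∀ x μ, |ρ (x + siteOf d ((n + 1) * s) (e μ)) - ρ x| ≤ 1 := fun x μ => torusDist_bond_lipschitz ((n + 1) * s) x c' μ
  have hres := inverseHessian_weighted_resolvent n a s ha hκ0.le hκ1 hm V hV ρ hρ h g hh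
  have hsrc := weightedSq_le_of_blockProfile n s hκ0 h2κ y₀ g hg
  have hsol : exp (2 * (κ * (∑ i, (((y i - y₀ i).valMinAbs.natAbs : ℕ) : ℝ)) - d * κ))
        * ∑ z : Fin d → Fin (n + 1), h (siteOf d ((n + 1) * s) (chart n (windowMap d s y) z)) ^ 2
      ≤ ∑ x, (exp (κ / ((n : ℝ) + 1) * ρ x) * h x) ^ 2 := by
    rw [Finset.mul_sum]
    refine le_trans (Finset.sum_le_sum fun z _ => ?_)
      (block_sum_le_total n s y (F := fun x => (exp (κ / ((n : ℝ) + 1) * ρ x) * h x) ^ 2) fun x => sq_nonneg _)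
    have hw := (weight_on_block n s y y₀ z hκ0.le).1
    simp only [hρ_def, hc']
    rw [mul_pow, ← exp_nat_mul, Nat.cast_ofNat]
    exact mul_le_mul_of_nonneg_right (exp_le_exp.2 (by linarith)) (sq_nonneg _)
  have hS0 : 0 ≤ ∑ x, (exp (κ / ((n : ℝ) + 1) * ρ x) * h x) ^ 2 := Finset.sum_nonneg fun _ _ => sq_nonneg _
  have hF0 : 0 ≤ ∑ x, (exp (κ / ((n : ℝ) + 1) * ρ x) * g x) ^ 2 := Finset.sum_nonneg fun _ _ => sq_nonneg _
  have hsq : ∑ x, (exp (κ / ((n : ℝ) + 1) * ρ x) * h x) ^ 2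
      ≤ (m⁻¹) ^ 2 * (G ^ 2 * exp (2 * d * κ) * (2 * (1 - exp (-(2 * κ)))⁻¹) ^ d) := by
    have h1 := pow_le_pow_left₀ (Real.sqrt_nonneg _) hres 2
    rw [Real.sq_sqrt hS0, mul_pow, Real.sq_sqrt hF0] at h1
    refine h1.trans (mul_le_mul_of_nonneg_left ?_ (sq_nonneg _))
    simpa only [hρ_def, hc'] using hsrc
  have hexp : 0 < exp (2 * (κ * (∑ i, (((y i - y₀ i).valMinAbs.natAbs : ℕ) : ℝ)) - d * κ)) := exp_pos _
  have key : ∑ z : Fin d → Fin (n + 1), h (siteOf d ((n + 1) * s) (chart n (windowMap d s y) z)) ^ 2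
      ≤ (m⁻¹) ^ 2 * (G ^ 2 * exp (2 * d * κ) * (2 * (1 - exp (-(2 * κ)))⁻¹) ^ d)
        / exp (2 * (κ * (∑ i, (((y i - y₀ i).valMinAbs.natAbs : ℕ) : ℝ)) - d * κ)) := by
    rw [le_div_iff₀ hexp, mul_comm]
    exact hsol.trans hsq
  refine key.trans (le_of_eq ?_)
  rw [div_eq_iff hexp.ne']
  have hE : exp (2 * d * κ) * exp (-(2 * κ * ∑ i, (((y i - y₀ i).valMinAbs.natAbs : ℕ) : ℝ)))
      * exp (2 * (κ * (∑ i, (((y i - y₀ i).valMinAbs.natAbs : ℕ) : ℝ)) - d * κ)) = 1 := by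
    rw [← exp_add, ← exp_add, ← exp_zero]; congr 1; ring
  calc (m⁻¹) ^ 2 * (G ^ 2 * exp (2 * d * κ) * (2 * (1 - exp (-(2 * κ)))⁻¹) ^ d)
      = (m⁻¹) ^ 2 * (G ^ 2 * exp (2 * d * κ) * (2 * (1 - exp (-(2 * κ)))⁻¹) ^ d) * (exp (2 * d * κ)
        * exp (-(2 * κ * ∑ i, (((y i - y₀ i).valMinAbs.natAbs : ℕ) : ℝ)))
        * exp (2 * (κ * (∑ i, (((y i - y₀ i).valMinAbs.natAbs : ℕ) : ℝ)) - d * κ))) := by rw [hE, mul_one]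
    _ = _ := by ring

end Solution

/-! ## §3. Two potentials: the propagator is Lipschitz in `V`, block-locally -/

section Lipschitz

variable (n : ℕ) (a : ℝ) (s : ℕ) [NeZero s]

/-- **THE DIFFERENCE OF TWO DISPLAYED ACTIONS IS DIAGONAL**: `(H_{V₁}u)(x) = (H_{V₂}u)(x) + (V₁ x − V₂ x)·u x`. [folklore] -/
theorem action_potential_sub (V₁ V₂ u : Site d ((n + 1) * s) → ℝ) (x : Site d ((n + 1) * s)) :
    ((n : ℝ) + 1) ^ 2 * ∑ μ, (2 * u x - u (x + siteOf d ((n + 1) * s) (e μ)) - u (x - siteOf d ((n + 1) * s) (e μ)))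
        + a / ((n : ℝ) + 1) ^ d * ∑ q ∈ B n (blk n (windowMap d ((n + 1) * s) x)), u (siteOf d ((n + 1) * s) q) + V₁ x * u x
      = (((n : ℝ) + 1) ^ 2 * ∑ μ, (2 * u x - u (x + siteOf d ((n + 1) * s) (e μ)) - u (x - siteOf d ((n + 1) * s) (e μ)))
        + a / ((n : ℝ) + 1) ^ d * ∑ q ∈ B n (blk n (windowMap d ((n + 1) * s) x)), u (siteOf d ((n + 1) * s) q) + V₂ x * u x)
        + (V₁ x - V₂ x) * u x := by
  ring

variable (ha : 0 ≤ a) {lam κ D : ℝ} (hκ0 : 0 < κ) (hκ1 : κ ≤ 1)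
  (hm : 0 < min 2 a - lam - 2 * d * κ ^ 2 - a * (exp (2 * d * κ) - 1))
  (V₁ V₂ : Site d ((n + 1) * s) → ℝ) (hV₁ : ∀ x, -lam ≤ V₁ x) (hV₂ : ∀ x, -lam ≤ V₂ x) (hD : ∀ x, |V₁ x - V₂ x| ≤ D)
  (y₀ : Site d s) (u₁ u₂ f : Site d ((n + 1) * s) → ℝ)
  (hf : ∀ x, siteOf d s (blk n (windowMap d ((n + 1) * s) x)) ≠ y₀ → f x = 0)
  (hu₁ : ∀ x, ((n : ℝ) + 1) ^ 2 * ∑ μ, (2 * u₁ x - u₁ (x + siteOf d ((n + 1) * s) (e μ)) - u₁ (x - siteOf d ((n + 1) * s) (e μ)))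
      + a / ((n : ℝ) + 1) ^ d * ∑ q ∈ B n (blk n (windowMap d ((n + 1) * s) x)), u₁ (siteOf d ((n + 1) * s) q) + V₁ x * u₁ x = f x)
  (hu₂ : ∀ x, ((n : ℝ) + 1) ^ 2 * ∑ μ, (2 * u₂ x - u₂ (x + siteOf d ((n + 1) * s) (e μ)) - u₂ (x - siteOf d ((n + 1) * s) (e μ)))
      + a / ((n : ℝ) + 1) ^ d * ∑ q ∈ B n (blk n (windowMap d ((n + 1) * s) x)), u₂ (siteOf d ((n + 1) * s) q) + V₂ x * u₂ x = f x)

include hu₁ hu₂ in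
/-- **THE SECOND RESOLVENT IDENTITY, DISPLAYED**: if `H_{V₁}u₁ = f` and `H_{V₂}u₂ = f` then `H_{V₁}(u₁ − u₂) = −(V₁ − V₂)·u₂` pointwise.
[folklore] -/
theorem action_sub_of_potentials (x : Site d ((n + 1) * s)) :
    ((n : ℝ) + 1) ^ 2 * ∑ μ, (2 * (u₁ x - u₂ x) - (u₁ (x + siteOf d ((n + 1) * s) (e μ)) - u₂ (x + siteOf d ((n + 1) * s) (e μ)))
          - (u₁ (x - siteOf d ((n + 1) * s) (e μ)) - u₂ (x - siteOf d ((n + 1) * s) (e μ))))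
        + a / ((n : ℝ) + 1) ^ d * ∑ q ∈ B n (blk n (windowMap d ((n + 1) * s) x)), (u₁ (siteOf d ((n + 1) * s) q) - u₂ (siteOf d ((n + 1) * s) q))
        + V₁ x * (u₁ x - u₂ x)
      = -((V₁ x - V₂ x) * u₂ x) := by
  rw [action_sub n a s V₁ u₁ u₂ x, hu₁ x, action_potential_sub n a s V₁ V₂ u₂ x, hu₂ x]
  ring

include ha hκ0 hκ1 hm hV₁ hV₂ hD hf hu₁ hu₂ in
/-- **THE PROPAGATOR IS LIPSCHITZ IN THE POTENTIAL, BLOCK-LOCALLY, MESH-FREE**: for two potentials `V₁, V₂ ≥ −λ` with `|V₁ − V₂| ≤ D`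
pointwise, a source `f` supported in the block `y₀` and the two solutions `H_{V_i}u_i = f`, over EVERY block `y`:
`Σ_z (u₁ − u₂)(σ(chart (wm y) z))² ≤ m_{κ∕2}⁻²·D²m_κ⁻²e^{4dκ}Σf²·e^{2dκ}K_κ·e^{dκ}·e^{−κρ_s(y,y₀)}` (`K_κ = (2∕(1 − e^{−κ}))^d`) — §2 on the source
`−(V₁ − V₂)u₂`, whose block profile is `D·` that of `u₂` ((138) `blockSq_le_of_block_source`, rate `κ`), read at the rate `κ∕2`. [folklore] -/
theorem blockSq_sub_le_of_potentials (y : Site d s) :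
    ∑ z : Fin d → Fin (n + 1), (u₁ (siteOf d ((n + 1) * s) (chart n (windowMap d s y) z)) - u₂ (siteOf d ((n + 1) * s) (chart n (windowMap d s y) z))) ^ 2
      ≤ ((min 2 a - lam - 2 * d * (κ / 2) ^ 2 - a * (exp (2 * d * (κ / 2)) - 1))⁻¹) ^ 2
          * ((D ^ 2 * (((min 2 a - lam - 2 * d * κ ^ 2 - a * (exp (2 * d * κ) - 1))⁻¹) ^ 2 * exp (4 * d * κ) * ∑ x, f x ^ 2))
            * exp (2 * d * (κ / 2)) * (2 * (1 - exp (-(2 * (κ / 2))))⁻¹) ^ d) * exp (2 * d * (κ / 2))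
        * exp (-(2 * (κ / 2) * ∑ i, (((y i - y₀ i).valMinAbs.natAbs : ℕ) : ℝ))) := by
  classical
  -- the source `g = −(V₁ − V₂)u₂` has block profile `D·(block profile of u₂)`
  have hu2 := blockSq_le_of_block_source n a s ha hκ0.le hκ1 hm V₂ hV₂ y₀ u₂ f hf hu₂
  have hD0 : 0 ≤ D := (abs_nonneg _).trans (hD (siteOf d ((n + 1) * s) (chart n (windowMap d s y₀) 0)))
  have hg : ∀ y'' : Site d s, ∑ z : Fin d → Fin (n + 1),
      (-((V₁ (siteOf d ((n + 1) * s) (chart n (windowMap d s y'') z)) - V₂ (siteOf d ((n + 1) * s) (chart n (windowMap d s y'') z)))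
        * u₂ (siteOf d ((n + 1) * s) (chart n (windowMap d s y'') z)))) ^ 2
      ≤ (√(D ^ 2 * (((min 2 a - lam - 2 * d * κ ^ 2 - a * (exp (2 * d * κ) - 1))⁻¹) ^ 2 * exp (4 * d * κ) * ∑ x, f x ^ 2))) ^ 2
        * exp (-(2 * κ * ∑ i, (((y'' i - y₀ i).valMinAbs.natAbs : ℕ) : ℝ))) := by
    intro y''
    have hF : 0 ≤ ∑ x, f x ^ 2 := Finset.sum_nonneg fun _ _ => sq_nonneg _
    rw [Real.sq_sqrt (by positivity)]
    calc ∑ z : Fin d → Fin (n + 1),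
          (-((V₁ (siteOf d ((n + 1) * s) (chart n (windowMap d s y'') z)) - V₂ (siteOf d ((n + 1) * s) (chart n (windowMap d s y'') z)))
            * u₂ (siteOf d ((n + 1) * s) (chart n (windowMap d s y'') z)))) ^ 2
        ≤ ∑ z : Fin d → Fin (n + 1), D ^ 2 * u₂ (siteOf d ((n + 1) * s) (chart n (windowMap d s y'') z)) ^ 2 := by
          refine Finset.sum_le_sum fun z _ => ?_
          rw [neg_sq, mul_pow, ← sq_abs (V₁ _ - V₂ _)]
          exact mul_le_mul_of_nonneg_right (pow_le_pow_left₀ (abs_nonneg _) (hD _) 2) (sq_nonneg _)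
      _ = D ^ 2 * ∑ z : Fin d → Fin (n + 1), u₂ (siteOf d ((n + 1) * s) (chart n (windowMap d s y'') z)) ^ 2 := by rw [Finset.mul_sum]
      _ ≤ D ^ 2 * (((min 2 a - lam - 2 * d * κ ^ 2 - a * (exp (2 * d * κ) - 1))⁻¹) ^ 2 * exp (4 * d * κ)
          * exp (-(2 * κ * ∑ i, (((y'' i - y₀ i).valMinAbs.natAbs : ℕ) : ℝ))) * ∑ x, f x ^ 2) :=
          mul_le_mul_of_nonneg_left (hu2 y'') (sq_nonneg _)
      _ = _ := by ring
  -- the rate `κ∕2`: floor monotone, `2(κ∕2) ≤ κ`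
  have hκ'0 : 0 < κ / 2 := by linarith
  have hκ'1 : κ / 2 ≤ 1 := by linarith
  have hm' : 0 < min 2 a - lam - 2 * d * (κ / 2) ^ 2 - a * (exp (2 * d * (κ / 2)) - 1) :=
    lt_of_lt_of_le hm (rate_mono (d := d) a ha hκ'0.le (by linarith))
  have h := blockSq_le_of_blockProfile_source n a s ha hκ'0 hκ'1 hm' (by linarith) V₁ hV₁ y₀ (fun x => u₁ x - u₂ x)
    (fun x => -((V₁ x - V₂ x) * u₂ x)) hg (fun x => action_sub_of_potentials n a s V₁ V₂ u₁ u₂ f hu₁ hu₂ x) y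
  have hF : 0 ≤ ∑ x, f x ^ 2 := Finset.sum_nonneg fun _ _ => sq_nonneg _
  rw [Real.sq_sqrt (by positivity)] at h
  exact h

end Lipschitz

/-! ## §4. THE END: the propagator of the torus road is Lipschitz in the background potential, block-locally, unconditionally -/

/-- **HEADLINE — `H_V⁻¹` IS LIPSCHITZ IN `V`, BLOCK-TO-BLOCK EXPONENTIALLY LOCALLY, every mesh, every volume.**  Fix `d`, `a ≥ 0`,
`λ < min(2,a)`.  THERE ARE `C, δ > 0` (functions of these only) such that for ALL `n, s`, ALL `V₁, V₂ ≥ −λ` with `|V₁ − V₂| ≤ D` pointwise,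
every block `y₀`, every source `f` supported in the block `y₀` and solutions `H_{V₁}u₁ = f`, `H_{V₂}u₂ = f`:
`Σ_z (u₁ − u₂)(σ(chart (wm y) z))² ≤ C·D²·e^{−2δρ_s(y,y₀)}·Σf²` for EVERY block `y`.  In the road, `V = u″∘φ`: the Hessian inverse at two
backgrounds differs, block-locally, by at most `sup|u″∘φ₁ − u″∘φ₂|` — the located regularity of the locality column in the field. [folklore] -/
theorem propagator_lipschitz (a : ℝ) (ha : 0 ≤ a) {lam : ℝ} (hm0 : 0 < min 2 a - lam) :
    ∃ C δ : ℝ, 0 < C ∧ 0 < δ ∧ ∀ (n s : ℕ) [NeZero s] (V₁ V₂ : Site d ((n + 1) * s) → ℝ), (∀ x, -lam ≤ V₁ x) → (∀ x, -lam ≤ V₂ x) →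
      ∀ D : ℝ, (∀ x, |V₁ x - V₂ x| ≤ D) →
      ∀ (y₀ : Site d s) (u₁ u₂ f : Site d ((n + 1) * s) → ℝ), (∀ x, siteOf d s (blk n (windowMap d ((n + 1) * s) x)) ≠ y₀ → f x = 0) →
      (∀ x, ((n : ℝ) + 1) ^ 2 * ∑ μ, (2 * u₁ x - u₁ (x + siteOf d ((n + 1) * s) (e μ)) - u₁ (x - siteOf d ((n + 1) * s) (e μ)))
        + a / ((n : ℝ) + 1) ^ d * ∑ q ∈ B n (blk n (windowMap d ((n + 1) * s) x)), u₁ (siteOf d ((n + 1) * s) q) + V₁ x * u₁ x = f x) →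
      (∀ x, ((n : ℝ) + 1) ^ 2 * ∑ μ, (2 * u₂ x - u₂ (x + siteOf d ((n + 1) * s) (e μ)) - u₂ (x - siteOf d ((n + 1) * s) (e μ)))
        + a / ((n : ℝ) + 1) ^ d * ∑ q ∈ B n (blk n (windowMap d ((n + 1) * s) x)), u₂ (siteOf d ((n + 1) * s) q) + V₂ x * u₂ x = f x) →
      ∀ y : Site d s, ∑ z : Fin d → Fin (n + 1),
          (u₁ (siteOf d ((n + 1) * s) (chart n (windowMap d s y) z)) - u₂ (siteOf d ((n + 1) * s) (chart n (windowMap d s y) z))) ^ 2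
        ≤ C * D ^ 2 * exp (-(2 * δ * ∑ i, (((y i - y₀ i).valMinAbs.natAbs : ℕ) : ℝ))) * ∑ x, f x ^ 2 := by
  have hd : (0 : ℝ) ≤ d := Nat.cast_nonneg d
  obtain ⟨κ, hκ0, hκ1, hκm⟩ := exists_rate (d := d) a ha hm0
  have hm : 0 < min 2 a - lam - 2 * d * κ ^ 2 - a * (exp (2 * d * κ) - 1) := by linarith
  set A : ℝ := ((min 2 a - lam - 2 * d * κ ^ 2 - a * (exp (2 * d * κ) - 1))⁻¹) ^ 2 with hA
  set A' : ℝ := ((min 2 a - lam - 2 * d * (κ / 2) ^ 2 - a * (exp (2 * d * (κ / 2)) - 1))⁻¹) ^ 2 with hA'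
  set K : ℝ := (2 * (1 - exp (-(2 * (κ / 2))))⁻¹) ^ d with hK
  have hK0 : 0 ≤ K := pow_nonneg (mul_nonneg zero_le_two (inv_nonneg.2 (sub_nonneg.2 (exp_le_one_iff.2 (by linarith))))) d
  refine ⟨A' * A * exp (4 * d * κ) * exp (2 * d * (κ / 2)) * K * exp (2 * d * (κ / 2)) + 1, κ / 2, by positivity, by linarith, ?_⟩
  intro n s _ V₁ V₂ hV₁ hV₂ D hD y₀ u₁ u₂ f hf hu₁ hu₂ y
  have h := blockSq_sub_le_of_potentials n a s ha hκ0 hκ1 hm V₁ V₂ hV₁ hV₂ hD y₀ u₁ u₂ f hf hu₁ hu₂ y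
  refine h.trans ?_
  have hF : 0 ≤ ∑ x, f x ^ 2 := Finset.sum_nonneg fun _ _ => sq_nonneg _
  have hE0 : 0 ≤ exp (-(2 * (κ / 2) * ∑ i, (((y i - y₀ i).valMinAbs.natAbs : ℕ) : ℝ))) := (exp_pos _).le
  have hD2 : 0 ≤ D ^ 2 := sq_nonneg _
  have hrew : A' * ((D ^ 2 * (A * exp (4 * d * κ) * ∑ x, f x ^ 2)) * exp (2 * d * (κ / 2)) * K) * exp (2 * d * (κ / 2))
        * exp (-(2 * (κ / 2) * ∑ i, (((y i - y₀ i).valMinAbs.natAbs : ℕ) : ℝ)))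
      = (A' * A * exp (4 * d * κ) * exp (2 * d * (κ / 2)) * K * exp (2 * d * (κ / 2))) * D ^ 2
        * exp (-(2 * (κ / 2) * ∑ i, (((y i - y₀ i).valMinAbs.natAbs : ℕ) : ℝ))) * ∑ x, f x ^ 2 := by ring
  rw [hrew]
  exact mul_le_mul_of_nonneg_right (mul_le_mul_of_nonneg_right (mul_le_mul_of_nonneg_right (le_add_of_nonneg_right zero_le_one) hD2)
    hE0) hF

/-! ## §5. Toy -/

/-- Toy (`d = 0`, `a = 1`, `λ = 0`): the headline's hypotheses are inhabited, so the constants exist. -/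
example : ∃ C δ : ℝ, 0 < C ∧ 0 < δ :=
  let ⟨C, δ, hC, hδ, _⟩ := propagator_lipschitz (d := 0) 1 zero_le_one (lam := 0) (by norm_num); ⟨C, δ, hC, hδ⟩

end Summit.QuantumFields.BalabanUV.T4Continuum.NE7b.SupTorusPropagatorModulus
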